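import Literature.Topology.FourManifolds.GaussDiagramsStabilityWindow
import Literature.Topology.FourManifolds.GaussDiagramsInsertPosition
import Literature.Topology.FourManifolds.GaussDiagramsOmega2Pattern
import HarnessLib

/-!
# The second Reidemeister move on readings: a bigon inside the window of a reading

Companion of `GaussDiagramsStabilityWindow.lean`, `GaussDiagramsInsertReading.lean`,
`GaussDiagramsInsertPosition.lean`, `GaussDiagramsOmega2Pattern.lean` (combinatorial layer of the
event analysis for the named fact `Knot.reidemeisterR`, direction `→`). At ONE time, let `θ` read
`G` off the window `W` on the pair `(γ, h)` (plane curve, heights), where `W` consists of the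
`η`-neighbourhoods of two parameters `α`, `β` modulo `2π`, and let the curve be injective on each
of the two windows. Then:

* `IsRegularReadingOff.isRegularReading_of_bigon_free` — if the two arcs `|s - α| < η`,
  `|u - β| < η` do not meet, `θ` is a regular reading of `G`;
* `IsRegularReadingOff.exists_rEquiv_isRegularReading_of_bigon` — if they meet in exactly two
  points `γ s₁ = γ u₁`, `γ s₂ = γ u₂` with non-zero crossing determinants of opposite signs and
  the `α`-arc above the `β`-arc, then `(γ, h)` has a regular reading of a Gauss diagram `G₂` with
  `G.REquiv G₂` — namely `G` with the two crossings inserted, a second Reidemeister move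
  `Ω2a/b` or `Ω2c/d` (`GaussDiagram.rEquiv_insertChord_insertChord`).

Together with the window stability (`IsRegularReadingOff.eventually_exists`) and the local model
`Literature.Analysis.Calculus.bigon_birth`, this is the passage of a generic isotopy through a
self-tangency. Pure bookkeeping (representatives of the new parameters in the period window of
`θ`, positions by `GaussDiagram.exists_insertParams₂`, listing by `IsReadingMod.insertChord_drop`);
no analysis and no named facts.

## References

* K. Reidemeister, *Knotentheorie*, Springer (1932), Kap. I §1 (`Ω2`). [Reidemeister1932]
* M. Polyak, *Minimal generating sets of Reidemeister moves*, Quantum Topol. 1 (2010), §1.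
  [Polyak2010]
-/

open Function Set

noncomputable section

namespace Literature.Topology.FourManifolds

/-! ### Helpers: shifting designated pairs; units from signs -/

/-- Shifting the two members of a designated pair by (different) multiples of the period.
[folklore] -/
theorem exists_pair_shift {s t v w c : ℝ} {k l : ℤ}
    (h : ({s + k * c, t + l * c} : Set ℝ) = {v, w}) (a b : ℤ) :
    ∃ k' l' : ℤ, ({s + k' * c, t + l' * c} : Set ℝ) = {v - a * c, w - b * c} := by
  rcases Set.pair_eq_pair_iff.1 h with ⟨h1, h2⟩ | ⟨h1, h2⟩
  · refine ⟨k - a, l - b, Set.pair_eq_pair_iff.2 (Or.inl ⟨?_, ?_⟩)⟩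
    · rw [← h1]; push_cast; ring
    · rw [← h2]; push_cast; ring
  · refine ⟨k - b, l - a, Set.pair_eq_pair_iff.2 (Or.inr ⟨?_, ?_⟩)⟩
    · rw [← h1]; push_cast; ring
    · rw [← h2]; push_cast; ring

/-- A non-zero real determinant defines a sign `±1` in `ℤˣ`. [folklore] -/
theorem exists_units_eq_sign {d : ℝ} (hd : d ≠ 0) :
    ∃ ε : ℤˣ, (ε : ℤ) = SignType.sign d ∧ ((-ε : ℤˣ) : ℤ) = -(SignType.sign d : ℤ) := by
  rcases lt_or_gt_of_ne hd with h | h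
  · exact ⟨-1, by simp [sign_neg h], by simp [sign_neg h]⟩
  · exact ⟨1, by simp [sign_pos h], by simp [sign_pos h]⟩

/-! ### The event at one time -/

section Static

variable {W : Set ℝ} {γ : ℝ → ℝ × ℝ} {h : ℝ → ℝ} {G : GaussDiagram} {θ : Fin (2 * G.n) → ℝ}
  {α β η : ℝ}

/-- **No bigon: the reading is regular.** Let `θ` read `G` off the window
`W = ⋃ₖ (α + 2πk - η, α + 2πk + η) ∪ (β + 2πk - η, β + 2πk + η)` on `(γ, h)`, `γ` periodic and
injective on `|s - α| < η` and on `|u - β| < η`. If the two arcs do not meet, `θ` is a regular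
reading of `G`. [cite: Reidemeister1932, Kap. I §1] -/
theorem IsRegularReadingOff.isRegularReading_of_bigon_free (hr : IsRegularReadingOff W γ h G θ)
    (hγper : Periodic γ (2 * Real.pi))
    (hW : ∀ s, s ∈ W ↔ ∃ k : ℤ, |s - α - k * (2 * Real.pi)| < η ∨ |s - β - k * (2 * Real.pi)| < η)
    (hinjα : ∀ s s', |s - α| < η → |s' - α| < η → γ s = γ s' → s = s')
    (hinjβ : ∀ u u', |u - β| < η → |u' - β| < η → γ u = γ u' → u = u')
    (hfree : ∀ s u, |s - α| < η → |u - β| < η → γ s ≠ γ u) :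
    IsRegularReading γ h G θ := by
  refine hr.isRegularReading fun s u hs hu hsu ↦ ?_
  obtain ⟨k, hk⟩ := (hW s).1 hs
  obtain ⟨l, hl⟩ := (hW u).1 hu
  have es : γ (s - k * (2 * Real.pi)) = γ s := hγper.sub_int_mul_eq k
  have eu : γ (u - l * (2 * Real.pi)) = γ u := hγper.sub_int_mul_eq l
  have hsu' : γ (s - k * (2 * Real.pi)) = γ (u - l * (2 * Real.pi)) := by rw [es, eu, hsu]
  have hk' : |s - k * (2 * Real.pi) - α| < η ∨ |s - k * (2 * Real.pi) - β| < η := by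
    simpa only [sub_right_comm] using hk
  have hl' : |u - l * (2 * Real.pi) - α| < η ∨ |u - l * (2 * Real.pi) - β| < η := by
    simpa only [sub_right_comm] using hl
  rcases hk' with hk' | hk' <;> rcases hl' with hl' | hl'
  · have e := hinjα _ _ hk' hl' hsu'
    exact ⟨l - k, by push_cast; linarith⟩
  · exact absurd hsu' (hfree _ _ hk' hl')
  · exact absurd hsu'.symm (hfree _ _ hl' hk')
  · have e := hinjβ _ _ hk' hl' hsu'
    exact ⟨l - k, by push_cast; linarith⟩

/-- **A bigon inside the window: a second Reidemeister move on the reading** (ordered form: the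
crossing `x` has the smaller `α`-parameter). See
`IsRegularReadingOff.exists_rEquiv_isRegularReading_of_bigon`. [cite: Reidemeister1932, Kap. I §1] -/
theorem IsRegularReadingOff.exists_rEquiv_isRegularReading_of_bigon_lt
    (hr : IsRegularReadingOff W γ h G θ) (hγper : Periodic γ (2 * Real.pi))
    (hhper : Periodic h (2 * Real.pi))
    (hW : ∀ s, s ∈ W ↔ ∃ k : ℤ, |s - α - k * (2 * Real.pi)| < η ∨ |s - β - k * (2 * Real.pi)| < η)
    {b : ℝ} (hb : ∀ q, θ q ∈ Ico b (b + 2 * Real.pi))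
    (hbα : ∀ k : ℤ, η < |b - α - k * (2 * Real.pi)|)
    (hbβ : ∀ k : ℤ, η < |b - β - k * (2 * Real.pi)|)
    (hsep : ∀ k : ℤ, 2 * η < |β - α - k * (2 * Real.pi)|)
    (hinjα : ∀ s s', |s - α| < η → |s' - α| < η → γ s = γ s' → s = s')
    (hinjβ : ∀ u u', |u - β| < η → |u' - β| < η → γ u = γ u' → u = u')
    {sx ux sy uy : ℝ} (hsx : |sx - α| < η) (hsy : |sy - α| < η) (hux : |ux - β| < η)
    (huy : |uy - β| < η) (hcx : γ sx = γ ux) (hcy : γ sy = γ uy) (hlt : sx < sy)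
    (huniq : ∀ s u, |s - α| < η → |u - β| < η → γ s = γ u →
      (s = sx ∧ u = ux) ∨ (s = sy ∧ u = uy))
    (hdetx : (deriv γ sx).1 * (deriv γ ux).2 - (deriv γ sx).2 * (deriv γ ux).1 ≠ 0)
    (hdet : SignType.sign ((deriv γ sx).1 * (deriv γ ux).2 - (deriv γ sx).2 * (deriv γ ux).1)
      = -SignType.sign ((deriv γ sy).1 * (deriv γ uy).2 - (deriv γ sy).2 * (deriv γ uy).1))
    (hover : ∀ s u, |s - α| < η → |u - β| < η → γ s = γ u → h u < h s) :
    ∃ (G₂ : GaussDiagram) (θ₂ : Fin (2 * G₂.n) → ℝ), G.REquiv G₂ ∧ IsRegularReading γ h G₂ θ₂ := by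
  have hc : (0 : ℝ) < 2 * Real.pi := Real.two_pi_pos
  set c : ℝ := 2 * Real.pi with hcdef
  -- (1) representatives `α' = α - kα c`, `β' = β - kβ c` in the period window `[b, b + c)`
  obtain ⟨kα, hkα⟩ := exists_int_sub_mul_two_pi_mem_Ico (α - b)
  obtain ⟨kβ, hkβ⟩ := exists_int_sub_mul_two_pi_mem_Ico (β - b)
  set α' : ℝ := α - kα * c with hα'
  set β' : ℝ := β - kβ * c with hβ'
  have hα'mem : b ≤ α' ∧ α' < b + c := by
    rw [mem_Ico] at hkα
    rw [hα']
    constructor <;> linarith [hkα.1, hkα.2]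
  have hβ'mem : b ≤ β' ∧ β' < b + c := by
    rw [mem_Ico] at hkβ
    rw [hβ']
    constructor <;> linarith [hkβ.1, hkβ.2]
  -- the windows around `α'`, `β'` fit into `(b, b + c)` and are disjoint
  have hα'lo : b + η < α' := by
    have h1 := hbα (-kα)
    have e : b - α - ((-kα : ℤ) : ℝ) * c = b - α' := by rw [hα']; push_cast; ring
    rw [e, abs_sub_comm, abs_of_nonneg (by linarith [hα'mem.1])] at h1
    linarith
  have hα'hi : α' < b + c - η := by
    have h1 := hbα (-kα - 1)
    have e : b - α - ((-kα - 1 : ℤ) : ℝ) * c = b + c - α' := by rw [hα']; push_cast; ring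
    rw [e, abs_of_nonneg (by linarith [hα'mem.2])] at h1
    linarith
  have hβ'lo : b + η < β' := by
    have h1 := hbβ (-kβ)
    have e : b - β - ((-kβ : ℤ) : ℝ) * c = b - β' := by rw [hβ']; push_cast; ring
    rw [e, abs_sub_comm, abs_of_nonneg (by linarith [hβ'mem.1])] at h1
    linarith
  have hβ'hi : β' < b + c - η := by
    have h1 := hbβ (-kβ - 1)
    have e : b - β - ((-kβ - 1 : ℤ) : ℝ) * c = b + c - β' := by rw [hβ']; push_cast; ring
    rw [e, abs_of_nonneg (by linarith [hβ'mem.2])] at h1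
    linarith
  have hdisj : 2 * η < |β' - α'| := by
    have h1 := hsep (kβ - kα)
    have e : β - α - ((kβ - kα : ℤ) : ℝ) * c = β' - α' := by rw [hα', hβ']; push_cast; ring
    rwa [e] at h1
  -- (2) the new values: the four crossing parameters, shifted into the period window
  set p1o : ℝ := sx - kα * c with hp1o
  set p1u : ℝ := ux - kβ * c with hp1u
  set p2o : ℝ := sy - kα * c with hp2o
  set p2u : ℝ := uy - kβ * c with hp2u
  have hp1oα : |p1o - α'| < η := by rw [hp1o, hα', show sx - kα * c - (α - kα * c) = sx - α by ring]; exact hsx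
  have hp2oα : |p2o - α'| < η := by rw [hp2o, hα', show sy - kα * c - (α - kα * c) = sy - α by ring]; exact hsy
  have hp1uβ : |p1u - β'| < η := by rw [hp1u, hβ', show ux - kβ * c - (β - kβ * c) = ux - β by ring]; exact hux
  have hp2uβ : |p2u - β'| < η := by rw [hp2u, hβ', show uy - kβ * c - (β - kβ * c) = uy - β by ring]; exact huy
  -- values near `α'`, `β'` lie in `W` and in the period window
  have hWα : ∀ v, |v - α'| < η → v ∈ W := fun v hv ↦ (hW v).2 ⟨-kα, Or.inl (by
    rw [show v - α - ((-kα : ℤ) : ℝ) * c = v - α' by rw [hα']; push_cast; ring]; exact hv)⟩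
  have hWβ : ∀ v, |v - β'| < η → v ∈ W := fun v hv ↦ (hW v).2 ⟨-kβ, Or.inr (by
    rw [show v - β - ((-kβ : ℤ) : ℝ) * c = v - β' by rw [hβ']; push_cast; ring]; exact hv)⟩
  have hIcoα : ∀ v, |v - α'| < η → v ∈ Ico b (b + c) := fun v hv ↦ by
    have := abs_lt.1 hv; constructor <;> linarith [this.1, this.2]
  have hIcoβ : ∀ v, |v - β'| < η → v ∈ Ico b (b + c) := fun v hv ↦ by
    have := abs_lt.1 hv; constructor <;> linarith [this.1, this.2]
  have hθW : ∀ q, θ q ∉ W := fun q hq ↦ hr.not_mem_closure q (subset_closure hq)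
  -- no value lies strictly between two values of the same window
  have hneW : ∀ {v : ℝ} (q), v ∈ W → θ q ≠ v := fun q hv he ↦ hθW q (he ▸ hv)
  have hαβne : ∀ {v w : ℝ}, |v - α'| < η → |w - β'| < η → v ≠ w := by
    intro v w hv hw hvw
    subst hvw
    have h1 := abs_lt.1 hv
    have h2 := abs_lt.1 hw
    have : |β' - α'| < 2 * η := abs_lt.2 ⟨by linarith, by linarith⟩
    linarith
  -- distinctness of the four new values and from the old parameters
  have hxy_u : ux ≠ uy := by
    intro he
    have : γ sx = γ sy := by rw [hcx, hcy, he]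
    exact absurd (hinjα sx sy hsx hsy this) (ne_of_lt hlt)
  have h12o : p1o ≠ p2o := by rw [hp1o, hp2o]; intro he; exact (ne_of_lt hlt) (by linarith)
  have h12u : p1u ≠ p2u := by rw [hp1u, hp2u]; intro he; exact hxy_u (by linarith)
  obtain ⟨o, u, o', u', θ₁, θ₂, hθ₁m, hθ₂m, hθ₁o, hθ₁u, hθ₁q, hθ₂o, hθ₂u, hθ₂r, hvals⟩ :=
    G.exists_insertParams₂ hr.strictMono (fun q ↦ hneW q (hWα _ hp1oα))
      (fun q ↦ hneW q (hWβ _ hp1uβ)) (fun q ↦ hneW q (hWα _ hp2oα))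
      (fun q ↦ hneW q (hWβ _ hp2uβ)) (hαβne hp1oα hp1uβ) h12o (hαβne hp1oα hp2uβ)
      (Ne.symm (hαβne hp2oα hp1uβ)) h12u (hαβne hp2oα hp2uβ)
  -- (3) period conditions
  have hθ₂Ico : ∀ i, θ₂ i ∈ Ico b (b + c) := by
    intro i
    rcases hvals i with e | e | e | e | ⟨q, e⟩ <;> rw [e]
    · exact hIcoα _ hp1oα
    · exact hIcoβ _ hp1uβ
    · exact hIcoα _ hp2oα
    · exact hIcoβ _ hp2uβ
    · exact hb q
  have hwin₂ : ∀ i j, θ₂ i < θ₂ j + 2 * Real.pi := GaussDiagram.lt_add_two_pi_of_mem_Ico hθ₂Ico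
  have hwin₁ : ∀ i j, θ₁ i < θ₁ j + 2 * Real.pi := by
    intro i j
    rw [← hθ₂r i, ← hθ₂r j]
    exact hwin₂ _ _
  -- (4) the reading modulo the two designated crossings
  set P : ℝ → ℝ → Prop := fun s t ↦ (∃ k l : ℤ, ({s + k * c, t + l * c} : Set ℝ) = {sx, ux}) ∨
    ∃ k l : ℤ, ({s + k * c, t + l * c} : Set ℝ) = {sy, uy} with hP
  have hrP : IsReadingMod P γ h G θ := by
    refine hr.isReadingMod fun s t hs ht hst ↦ ?_
    obtain ⟨k, hk⟩ := (hW s).1 hs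
    obtain ⟨l, hl⟩ := (hW t).1 ht
    have es : γ (s - k * c) = γ s := hγper.sub_int_mul_eq k
    have et : γ (t - l * c) = γ t := hγper.sub_int_mul_eq l
    have hst' : γ (s - k * c) = γ (t - l * c) := by rw [es, et, hst]
    have hk' : |s - k * c - α| < η ∨ |s - k * c - β| < η := by
      simpa only [sub_right_comm] using hk
    have hl' : |t - l * c - α| < η ∨ |t - l * c - β| < η := by
      simpa only [sub_right_comm] using hl
    rcases hk' with hk' | hk' <;> rcases hl' with hl' | hl'
    · left
      have e := hinjα _ _ hk' hl' hst'
      exact ⟨l - k, by push_cast; linarith⟩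
    · right
      rcases huniq _ _ hk' hl' hst' with ⟨e1, e2⟩ | ⟨e1, e2⟩
      · refine Or.inl ⟨-k, -l, Set.pair_eq_pair_iff.2 (Or.inl ⟨?_, ?_⟩)⟩
        · rw [← e1]; push_cast; ring
        · rw [← e2]; push_cast; ring
      · refine Or.inr ⟨-k, -l, Set.pair_eq_pair_iff.2 (Or.inl ⟨?_, ?_⟩)⟩
        · rw [← e1]; push_cast; ring
        · rw [← e2]; push_cast; ring
    · right
      rcases huniq _ _ hl' hk' hst'.symm with ⟨e1, e2⟩ | ⟨e1, e2⟩
      · refine Or.inl ⟨-k, -l, Set.pair_eq_pair_iff.2 (Or.inr ⟨?_, ?_⟩)⟩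
        · rw [← e2]; push_cast; ring
        · rw [← e1]; push_cast; ring
      · refine Or.inr ⟨-k, -l, Set.pair_eq_pair_iff.2 (Or.inr ⟨?_, ?_⟩)⟩
        · rw [← e2]; push_cast; ring
        · rw [← e1]; push_cast; ring
    · left
      have e := hinjβ _ _ hk' hl' hst'
      exact ⟨l - k, by push_cast; linarith⟩
  -- (5) periodic transfers of the crossing data to the representatives
  have hdγ : Periodic (deriv γ) c := periodic_deriv_of_periodic hγper
  have eγ1o : γ p1o = γ sx := hγper.sub_int_mul_eq kα
  have eγ1u : γ p1u = γ ux := hγper.sub_int_mul_eq kβ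
  have eγ2o : γ p2o = γ sy := hγper.sub_int_mul_eq kα
  have eγ2u : γ p2u = γ uy := hγper.sub_int_mul_eq kβ
  have eh1o : h p1o = h sx := hhper.sub_int_mul_eq kα
  have eh1u : h p1u = h ux := hhper.sub_int_mul_eq kβ
  have eh2o : h p2o = h sy := hhper.sub_int_mul_eq kα
  have eh2u : h p2u = h uy := hhper.sub_int_mul_eq kβ
  have ed1o : deriv γ p1o = deriv γ sx := hdγ.sub_int_mul_eq kα
  have ed1u : deriv γ p1u = deriv γ ux := hdγ.sub_int_mul_eq kβ
  have ed2o : deriv γ p2o = deriv γ sy := hdγ.sub_int_mul_eq kα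
  have ed2u : deriv γ p2u = deriv γ uy := hdγ.sub_int_mul_eq kβ
  obtain ⟨ε, hε, hε'⟩ := exists_units_eq_sign hdetx
  -- (6) insert the crossing `x` (sign `ε`), dropping its designation
  set Q : ℝ → ℝ → Prop := fun s t ↦ ∃ k l : ℤ, ({s + k * c, t + l * c} : Set ℝ) = {sy, uy} with hQ
  have hPQ : ∀ s t, P s t → Q s t ∨ ∃ k l : ℤ,
      ({s + k * (2 * Real.pi), t + l * (2 * Real.pi)} : Set ℝ) = {p1o, p1u} := by
    rintro s t (⟨k, l, hkl⟩ | hQ')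
    · exact Or.inr (exists_pair_shift hkl kα kβ)
    · exact Or.inl hQ'
  have hr₁ : IsReadingMod Q γ h (G.insertChord o u ε) θ₁ := by
    refine hrP.insertChord_drop o u hθ₁m hwin₁ hθ₁o hθ₁u hθ₁q ?_ ?_ ?_ hPQ
    · rw [eγ1o, eγ1u, hcx]
    · rw [eh1o, eh1u]
      exact hover sx ux hsx hux hcx
    · rw [Matrix.det_fin_two_of, ed1o, ed1u]
      exact hε
  -- (7) insert the crossing `y` (sign `-ε`), dropping its designation
  have hQR : ∀ s t, Q s t → False ∨ ∃ k l : ℤ,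
      ({s + k * (2 * Real.pi), t + l * (2 * Real.pi)} : Set ℝ) = {p2o, p2u} := by
    rintro s t ⟨k, l, hkl⟩
    exact Or.inr (exists_pair_shift hkl kα kβ)
  have hr₂ : IsReadingMod (fun _ _ ↦ False) γ h ((G.insertChord o u ε).insertChord o' u' (-ε)) θ₂ := by
    refine hr₁.insertChord_drop o' u' hθ₂m hwin₂ hθ₂o hθ₂u hθ₂r ?_ ?_ ?_ hQR
    · rw [eγ2o, eγ2u, hcy]
    · rw [eh2o, eh2u]
      exact hover sy uy hsy huy hcy
    · rw [Matrix.det_fin_two_of, ed2o, ed2u, hε', ← SignType.coe_neg, hdet, neg_neg]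
  have hreg : IsRegularReading γ h ((G.insertChord o u ε).insertChord o' u' (-ε)) θ₂ :=
    hr₂.isRegularReading fun _ _ hF ↦ hF.elim
  -- (8) the double insertion is a second Reidemeister move: the new parameters are consecutive
  have hbetweenα : ∀ {v : ℝ}, p1o < v → v < p2o → |v - α'| < η := fun h1 h2 ↦ by
    have := abs_lt.1 hp1oα; have := abs_lt.1 hp2oα
    exact abs_lt.2 ⟨by linarith, by linarith⟩
  have hbetweenβ : ∀ {v a₁ a₂ : ℝ}, |a₁ - β'| < η → |a₂ - β'| < η → a₁ < v → v < a₂ →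
      |v - β'| < η := fun h₁ h₂ h1 h2 ↦ by
    have := abs_lt.1 h₁; have := abs_lt.1 h₂
    exact abs_lt.2 ⟨by linarith, by linarith⟩
  have hgapα : ∀ r, p1o < θ₂ r → p2o ≤ θ₂ r := by
    intro r h1
    by_contra h2
    push Not at h2
    have hv : |θ₂ r - α'| < η := hbetweenα h1 h2
    rcases hvals r with e | e | e | e | ⟨q, e⟩
    · rw [e] at h1; exact lt_irrefl _ h1
    · exact hαβne hv (e ▸ hp1uβ) rfl
    · rw [e] at h2; exact lt_irrefl _ h2
    · exact hαβne hv (e ▸ hp2uβ) rfl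
    · exact hθW q (e ▸ hWα _ hv)
  have hgapβ : ∀ {a₁ a₂ : ℝ}, |a₁ - β'| < η → |a₂ - β'| < η → (a₁ = p1u ∨ a₁ = p2u) →
      (a₂ = p1u ∨ a₂ = p2u) → ∀ r, a₁ < θ₂ r → a₂ ≤ θ₂ r := by
    intro a₁ a₂ ha₁ ha₂ ha₁' ha₂' r h1
    by_contra h2
    push Not at h2
    have hv : |θ₂ r - β'| < η := hbetweenβ ha₁ ha₂ h1 h2
    rcases hvals r with e | e | e | e | ⟨q, e⟩
    · exact hαβne (e ▸ hp1oα) hv rfl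
    · rcases ha₁' with rfl | rfl
      · rw [e] at h1; exact lt_irrefl _ h1
      · rcases ha₂' with rfl | rfl
        · rw [e] at h2; exact lt_irrefl _ h2
        · exact absurd (h1.trans h2) (lt_irrefl _)
    · exact hαβne (e ▸ hp2oα) hv rfl
    · rcases ha₁' with rfl | rfl
      · rcases ha₂' with rfl | rfl
        · exact absurd (h1.trans h2) (lt_irrefl _)
        · rw [e] at h2; exact lt_irrefl _ h2
      · rw [e] at h1; exact lt_irrefl _ h1
    · exact hθW q (e ▸ hWβ _ hv)
  -- the values at the positions of the two new chords
  have exo : ((G.insertChord o u ε).insertChord o' u' (-ε)).overPos (Fin.last G.n).castSucc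
      = o'.succAbove (u'.succAbove ((G.insertChord o u ε).overPos (Fin.last G.n))) :=
    GaussDiagram.insertChord_overPos_castSucc (G.insertChord o u ε) o' u' (-ε) (Fin.last G.n)
  have exo' : (G.insertChord o u ε).overPos (Fin.last G.n) = o :=
    GaussDiagram.insertChord_overPos_last G o u ε
  have eyo : ((G.insertChord o u ε).insertChord o' u' (-ε)).overPos (Fin.last (G.n + 1)) = o' :=
    GaussDiagram.insertChord_overPos_last (G.insertChord o u ε) o' u' (-ε)
  have exu : ((G.insertChord o u ε).insertChord o' u' (-ε)).underPos (Fin.last G.n).castSucc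
      = o'.succAbove (u'.succAbove ((G.insertChord o u ε).underPos (Fin.last G.n))) :=
    GaussDiagram.insertChord_underPos_castSucc (G.insertChord o u ε) o' u' (-ε) (Fin.last G.n)
  have exu' : (G.insertChord o u ε).underPos (Fin.last G.n) = o.succAbove u :=
    GaussDiagram.insertChord_underPos_last G o u ε
  have eyu : ((G.insertChord o u ε).insertChord o' u' (-ε)).underPos (Fin.last (G.n + 1))
      = o'.succAbove u' :=
    GaussDiagram.insertChord_underPos_last (G.insertChord o u ε) o' u' (-ε)
  have vxo : θ₂ (((G.insertChord o u ε).insertChord o' u' (-ε)).overPos (Fin.last G.n).castSucc)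
      = p1o := by
    rw [exo, exo', hθ₂r, hθ₁o]
  have vyo : θ₂ (((G.insertChord o u ε).insertChord o' u' (-ε)).overPos (Fin.last (G.n + 1)))
      = p2o := by
    rw [eyo, hθ₂o]
  have vxu : θ₂ (((G.insertChord o u ε).insertChord o' u' (-ε)).underPos (Fin.last G.n).castSucc)
      = p1u := by
    rw [exu, exu', hθ₂r, hθ₁u]
  have vyu : θ₂ (((G.insertChord o u ε).insertChord o' u' (-ε)).underPos (Fin.last (G.n + 1)))
      = p2u := by
    rw [eyu, hθ₂u]
  have hp12o : p1o < p2o := by rw [hp1o, hp2o]; linarith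
  have hmove : G.REquiv ((G.insertChord o u ε).insertChord o' u' (-ε)) := by
    refine G.rEquiv_insertChord_insertChord o u o' u' ε hθ₂m ?_ ?_ ?_
    · rw [vxo, vyo]; exact hp12o
    · intro r hr'
      rw [vxo] at hr'
      rw [vyo]
      exact hgapα r hr'
    · rcases lt_or_gt_of_ne h12u with hlt' | hlt'
      · left
        refine ⟨by rw [vxu, vyu]; exact hlt', fun r hr' ↦ ?_⟩
        rw [vxu] at hr'
        rw [vyu]
        exact hgapβ hp1uβ hp2uβ (Or.inl rfl) (Or.inr rfl) r hr'
      · right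
        refine ⟨by rw [vxu, vyu]; exact hlt', fun r hr' ↦ ?_⟩
        rw [vyu] at hr'
        rw [vxu]
        exact hgapβ hp2uβ hp1uβ (Or.inr rfl) (Or.inl rfl) r hr'
  exact ⟨(G.insertChord o u ε).insertChord o' u' (-ε), θ₂, hmove, hreg⟩

/-- **A bigon inside the window: a second Reidemeister move on the reading.** Let `θ` read `G`
off the window `W` (the `η`-neighbourhoods of `α`, `β` modulo `2π`) on `(γ, h)` (both
`2π`-periodic), with the period window `[b, b + 2π)` of `θ` at distance `> η` from `α`, `β` modulo
`2π` and the two windows `2η`-separated modulo `2π`; let `γ` be injective on each window. Suppose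
the two arcs meet in exactly two crossings `γ s₁ = γ u₁`, `γ s₂ = γ u₂` (`s₁ ≠ s₂`) with non-zero
determinants of opposite signs, the `α`-arc passing over. Then `(γ, h)` has a regular reading of a
Gauss diagram `G₂` with `G.REquiv G₂`: the two crossings inserted into `G`, a move `Ω2a/b` or
`Ω2c/d`. (For the `β`-arc over, exchange the roles of `(α, sᵢ)` and `(β, uᵢ)`.)
[cite: Reidemeister1932, Kap. I §1] -/
theorem IsRegularReadingOff.exists_rEquiv_isRegularReading_of_bigon
    (hr : IsRegularReadingOff W γ h G θ) (hγper : Periodic γ (2 * Real.pi))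
    (hhper : Periodic h (2 * Real.pi))
    (hW : ∀ s, s ∈ W ↔ ∃ k : ℤ, |s - α - k * (2 * Real.pi)| < η ∨ |s - β - k * (2 * Real.pi)| < η)
    {b : ℝ} (hb : ∀ q, θ q ∈ Ico b (b + 2 * Real.pi))
    (hbα : ∀ k : ℤ, η < |b - α - k * (2 * Real.pi)|)
    (hbβ : ∀ k : ℤ, η < |b - β - k * (2 * Real.pi)|)
    (hsep : ∀ k : ℤ, 2 * η < |β - α - k * (2 * Real.pi)|)
    (hinjα : ∀ s s', |s - α| < η → |s' - α| < η → γ s = γ s' → s = s')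
    (hinjβ : ∀ u u', |u - β| < η → |u' - β| < η → γ u = γ u' → u = u')
    {s₁ u₁ s₂ u₂ : ℝ} (hs₁ : |s₁ - α| < η) (hs₂ : |s₂ - α| < η) (hu₁ : |u₁ - β| < η)
    (hu₂ : |u₂ - β| < η) (hc₁ : γ s₁ = γ u₁) (hc₂ : γ s₂ = γ u₂) (hs₁₂ : s₁ ≠ s₂)
    (huniq : ∀ s u, |s - α| < η → |u - β| < η → γ s = γ u →
      (s = s₁ ∧ u = u₁) ∨ (s = s₂ ∧ u = u₂))
    (hdet₁ : (deriv γ s₁).1 * (deriv γ u₁).2 - (deriv γ s₁).2 * (deriv γ u₁).1 ≠ 0)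
    (hdet : SignType.sign ((deriv γ s₁).1 * (deriv γ u₁).2 - (deriv γ s₁).2 * (deriv γ u₁).1)
      = -SignType.sign ((deriv γ s₂).1 * (deriv γ u₂).2 - (deriv γ s₂).2 * (deriv γ u₂).1))
    (hover : ∀ s u, |s - α| < η → |u - β| < η → γ s = γ u → h u < h s) :
    ∃ (G₂ : GaussDiagram) (θ₂ : Fin (2 * G₂.n) → ℝ), G.REquiv G₂ ∧ IsRegularReading γ h G₂ θ₂ := by
  rcases lt_or_gt_of_ne hs₁₂ with hlt | hlt
  · exact hr.exists_rEquiv_isRegularReading_of_bigon_lt hγper hhper hW hb hbα hbβ hsep hinjα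
      hinjβ hs₁ hs₂ hu₁ hu₂ hc₁ hc₂ hlt huniq hdet₁ hdet hover
  · have hdet₂ : (deriv γ s₂).1 * (deriv γ u₂).2 - (deriv γ s₂).2 * (deriv γ u₂).1 ≠ 0 := by
      intro h0
      rw [h0, sign_zero, neg_zero, sign_eq_zero_iff] at hdet
      exact hdet₁ hdet
    have hdet' : SignType.sign ((deriv γ s₂).1 * (deriv γ u₂).2 - (deriv γ s₂).2 * (deriv γ u₂).1)
        = -SignType.sign ((deriv γ s₁).1 * (deriv γ u₁).2 - (deriv γ s₁).2 * (deriv γ u₁).1) := by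
      rw [hdet, neg_neg]
    exact hr.exists_rEquiv_isRegularReading_of_bigon_lt hγper hhper hW hb hbα hbβ hsep hinjα
      hinjβ hs₂ hs₁ hu₂ hu₁ hc₂ hc₁ hlt (fun s u hs hu hsu ↦ (huniq s u hs hu hsu).symm) hdet₂
      hdet' hover

end Static

end Literature.Topology.FourManifolds
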